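import Summits.ResolutionOfSingularities.ResolutionOfSingularities.Theorems.FrobeniusLadderFInjectiveMacaulayficationToricChartFedder
import Mathlib.Algebra.MvPolynomial.PDeriv
import Mathlib.LinearAlgebra.Matrix.NonsingularInverse
import Mathlib.LinearAlgebra.Matrix.Determinant.Basic
import Mathlib.Data.Fin.VecNotation
import HarnessLib

/-!
# Transport of logarithmic `2 × 2` Jacobian minors along a toric chart (crux `FInjectiveMacaulayfication`, K-T4 / file 12a)

[OURS · L1 W4.5a] Support file for crux stmt-ResolutionOfSingularities-15315 (seat table v5, stub-6; planner rulings R11.4,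
R11.12: `CIThetaTransport`, codimension `c = 2`).  For the chart map `θ : X_j ↦ ∏ᵢ Yᵢ ^ V i j` of a unimodular exponent matrix
`V` (tree: `ToricChartFedder.theta_monomial`) we prove the **logarithmic chain rule**
`Yᵢ ∂_{Yᵢ} (θ q) = Σ_j V i j · θ (X_j ∂_{X_j} q)` (`X_mul_pderiv_theta`) and its inverse form through `U = V⁻¹ ∈ GLₙ(ℤ)`
(`theta_X_mul_pderiv`); hence the image under `θ` of a logarithmic `2 × 2` minor `det (X_{c a} ∂_{X_{c a}} P_l)_{a,l}` lies in the
ideal of the logarithmic `2 × 2` minors of `θ P` (`theta_logMinor_mem`), and a logarithmic minor of `(Y^{d₀} h₀, Y^{d₁} h₁)` lies in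
`(h₀, h₁) + (plain 2 × 2 minors of h)` (`logMinor_monomial_mul_mem`).  Combined (`theta_logMinor_mem_sup`): if `θ P_l = Y^{d_l} · h_l`
then `θ (log-minor of P) ∈ (h₀, h₁) + (minors of h)`.  This is the derivative bookkeeping of the cell-to-chart transport
`CIThetaTransport` (companion file), which turns the X-coordinate CELL certificates (`T11PlusCells`, `T4PlusCells`, checked by
`CIPolyKitCells.hcert_two_torus_of_lists`) into the Y-coordinate `hcert` entries of `CISmoothChart` /
`CIConeFiModelSmooth.ciConeFiModelRel_of_smoothFaceCertificates`.
No definition is declared; AI-written, weaker than expert review; no statement of [claim: Hironaka2017] is used. [folklore]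
-/

-- single-problem summit: the doubled namespace component is forced
set_option linter.dupNamespace false

noncomputable section

namespace Summit.ResolutionOfSingularities.ResolutionOfSingularities.Theorems.FInjectiveMacaulayfication.CIThetaTransport

open MvPolynomial

variable {k : Type} [CommRing k] {n : ℕ}

/-! ## The logarithmic chain rule for `θ` -/

/-- Euler on one monomial: `Xᵢ · ∂ᵢ (monomial s a) = sᵢ · monomial s a`. [folklore] -/
theorem X_mul_pderiv_monomial (i : Fin n) (s : Fin n →₀ ℕ) (a : k) :
    (X i : MvPolynomial (Fin n) k) * pderiv i (monomial s a) = monomial s (a * (s i : ℕ)) := by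
  rw [pderiv_monomial]
  by_cases hs : s i = 0
  · rw [hs, Nat.cast_zero, mul_zero, map_zero, map_zero, mul_zero]
  · rw [X, monomial_mul, one_mul, add_tsub_cancel_of_le (Finsupp.single_le_iff.mpr (Nat.one_le_iff_ne_zero.mpr hs))]

/-- A natural-number scalar times a monomial. [folklore] -/
theorem natCast_mul_monomial (m : ℕ) (s : Fin n →₀ ℕ) (a : k) :
    (m : MvPolynomial (Fin n) k) * monomial s a = monomial s ((m : k) * a) := by
  rw [← map_natCast (C : k →+* MvPolynomial (Fin n) k) m, C_mul_monomial]

/-- An integer scalar times a monomial. [folklore] -/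
theorem intCast_mul_monomial (m : ℤ) (s : Fin n →₀ ℕ) (a : k) :
    (m : MvPolynomial (Fin n) k) * monomial s a = monomial s ((m : k) * a) := by
  rw [← map_intCast (C : k →+* MvPolynomial (Fin n) k) m, C_mul_monomial]

/-- **The logarithmic chain rule** for the chart map `θ : X_j ↦ ∏ᵢ Yᵢ ^ V i j`:
`Yᵢ · ∂_{Yᵢ} (θ q) = Σ_j V i j · θ (X_j · ∂_{X_j} q)`. [folklore] -/
theorem X_mul_pderiv_theta (V : Matrix (Fin n) (Fin n) ℕ) (q : MvPolynomial (Fin n) k) (i : Fin n) :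
    (X i : MvPolynomial (Fin n) k) *
        pderiv i (aeval (fun j : Fin n => ∏ i : Fin n, (X i : MvPolynomial (Fin n) k) ^ V i j) q) =
      ∑ j : Fin n, (V i j : MvPolynomial (Fin n) k) *
        aeval (fun j : Fin n => ∏ i : Fin n, (X i : MvPolynomial (Fin n) k) ^ V i j) (X j * pderiv j q) := by
  induction q using MvPolynomial.induction_on' with
  | monomial u a =>
    rw [ToricChartFedder.theta_monomial, X_mul_pderiv_monomial]
    conv_rhs => arg 2; ext j; rw [X_mul_pderiv_monomial, ToricChartFedder.theta_monomial, natCast_mul_monomial]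
    rw [← map_sum]
    congr 1
    rw [ToricChartFedder.expMap_apply, Nat.cast_sum, Finset.mul_sum]
    refine Finset.sum_congr rfl fun j _ => ?_
    push_cast
    ring
  | add p q hp hq =>
    simp only [map_add, mul_add, hp, hq, Finset.sum_add_distrib]

/-- **The inverse logarithmic chain rule**: for `V` unimodular with integer inverse `U = V⁻¹`,
`θ (X_j · ∂_{X_j} q) = Σ_i U j i · Yᵢ · ∂_{Yᵢ} (θ q)`. [folklore] -/
theorem theta_X_mul_pderiv (V : Matrix (Fin n) (Fin n) ℕ) (hV : IsUnit (V.map (Nat.cast : ℕ → ℤ)).det)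
    (q : MvPolynomial (Fin n) k) (j : Fin n) :
    aeval (fun j : Fin n => ∏ i : Fin n, (X i : MvPolynomial (Fin n) k) ^ V i j) (X j * pderiv j q) =
      ∑ i : Fin n, (((V.map (Nat.cast : ℕ → ℤ))⁻¹ j i : ℤ) : MvPolynomial (Fin n) k) *
        ((X i : MvPolynomial (Fin n) k) *
          pderiv i (aeval (fun j : Fin n => ∏ i : Fin n, (X i : MvPolynomial (Fin n) k) ^ V i j) q)) := by
  have hUV : (V.map (Nat.cast : ℕ → ℤ))⁻¹ * V.map (Nat.cast : ℕ → ℤ) = 1 := Matrix.nonsing_inv_mul _ hV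
  have hsum : ∀ j' : Fin n,
      (∑ i : Fin n, (((V.map (Nat.cast : ℕ → ℤ))⁻¹ j i : ℤ) : MvPolynomial (Fin n) k) * (V i j' : MvPolynomial (Fin n) k)) =
        if j = j' then 1 else 0 := by
    intro j'
    have h := congrArg (fun M : Matrix (Fin n) (Fin n) ℤ => (M j j' : MvPolynomial (Fin n) k)) hUV
    simp only [Matrix.mul_apply, Matrix.map_apply, Matrix.one_apply, Int.cast_sum, Int.cast_mul, Int.cast_natCast,
      Int.cast_ite, Int.cast_one, Int.cast_zero] at h
    exact h
  simp_rw [X_mul_pderiv_theta V q, Finset.mul_sum, ← mul_assoc]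
  rw [Finset.sum_comm]
  simp_rw [← Finset.sum_mul, hsum, ite_mul, one_mul, zero_mul, Finset.sum_ite_eq, Finset.mem_univ, if_true]

/-! ## Logarithmic `2 × 2` minors -/

/-- Expansion of a logarithmic `2 × 2` minor. [folklore] -/
theorem logMinor_two (v : Fin 2 → Fin n) (Q : Fin 2 → MvPolynomial (Fin n) k) :
    (Matrix.of fun a l => (X (v a) : MvPolynomial (Fin n) k) * pderiv (v a) (Q l)).det =
      X (v 0) * pderiv (v 0) (Q 0) * (X (v 1) * pderiv (v 1) (Q 1)) -
        X (v 0) * pderiv (v 0) (Q 1) * (X (v 1) * pderiv (v 1) (Q 0)) := by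
  rw [Matrix.det_fin_two]
  rfl

/-- Expansion of a plain `2 × 2` Jacobian minor. [folklore] -/
theorem minor_two (v : Fin 2 → Fin n) (Q : Fin 2 → MvPolynomial (Fin n) k) :
    (Matrix.of fun a l => pderiv (v a) (Q l)).det =
      pderiv (v 0) (Q 0) * pderiv (v 1) (Q 1) - pderiv (v 0) (Q 1) * pderiv (v 1) (Q 0) := by
  rw [Matrix.det_fin_two]
  rfl

/-- **Transport of a logarithmic minor**: for `V` unimodular, the image under `θ` of the logarithmic `2 × 2` minor of `(P₀, P₁)` on
the columns `c 0, c 1` lies in the ideal generated by the logarithmic `2 × 2` minors of `(θ P₀, θ P₁)` (on all pairs of columns).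
[folklore] -/
theorem theta_logMinor_mem (V : Matrix (Fin n) (Fin n) ℕ) (hV : IsUnit (V.map (Nat.cast : ℕ → ℤ)).det)
    (P : Fin 2 → MvPolynomial (Fin n) k) (c : Fin 2 → Fin n) :
    aeval (fun j : Fin n => ∏ i : Fin n, (X i : MvPolynomial (Fin n) k) ^ V i j)
        (Matrix.of fun a l => (X (c a) : MvPolynomial (Fin n) k) * pderiv (c a) (P l)).det ∈
      Ideal.span (Set.range fun ii' : Fin n × Fin n =>
        (Matrix.of fun a l => (X (![ii'.1, ii'.2] a) : MvPolynomial (Fin n) k) * pderiv (![ii'.1, ii'.2] a)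
          (aeval (fun j : Fin n => ∏ i : Fin n, (X i : MvPolynomial (Fin n) k) ^ V i j) (P l))).det) := by
  rw [logMinor_two, map_sub, map_mul _ (X (c 0) * _) (X (c 1) * _), map_mul _ (X (c 0) * _) (X (c 1) * _),
    theta_X_mul_pderiv V hV, theta_X_mul_pderiv V hV, theta_X_mul_pderiv V hV, theta_X_mul_pderiv V hV,
    Finset.sum_mul_sum, Finset.sum_mul_sum, ← Finset.sum_sub_distrib]
  refine Ideal.sum_mem _ fun i _ => ?_
  rw [← Finset.sum_sub_distrib]
  refine Ideal.sum_mem _ fun i' _ => ?_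
  have hgen : (Matrix.of fun a l => (X (![i, i'] a) : MvPolynomial (Fin n) k) * pderiv (![i, i'] a)
      (aeval (fun j : Fin n => ∏ i : Fin n, (X i : MvPolynomial (Fin n) k) ^ V i j) (P l))).det ∈
      Ideal.span (Set.range fun ii' : Fin n × Fin n =>
        (Matrix.of fun a l => (X (![ii'.1, ii'.2] a) : MvPolynomial (Fin n) k) * pderiv (![ii'.1, ii'.2] a)
          (aeval (fun j : Fin n => ∏ i : Fin n, (X i : MvPolynomial (Fin n) k) ^ V i j) (P l))).det) :=
    Ideal.subset_span ⟨(i, i'), rfl⟩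
  rw [logMinor_two] at hgen
  simp only [Matrix.cons_val_zero, Matrix.cons_val_one] at hgen
  convert Ideal.mul_mem_left _ ((((V.map (Nat.cast : ℕ → ℤ))⁻¹ (c 0) i : ℤ) : MvPolynomial (Fin n) k) *
      (((V.map (Nat.cast : ℕ → ℤ))⁻¹ (c 1) i' : ℤ) : MvPolynomial (Fin n) k)) hgen using 1
  ring

/-- Euler on a monomial factor: `Yᵢ · ∂ᵢ (Y^d · h) = Y^d · (dᵢ · h + Yᵢ · ∂ᵢ h)`. [folklore] -/
theorem X_mul_pderiv_monomial_mul (i : Fin n) (d : Fin n →₀ ℕ) (h : MvPolynomial (Fin n) k) :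
    (X i : MvPolynomial (Fin n) k) * pderiv i (monomial d 1 * h) =
      monomial d 1 * (((d i : ℕ) : MvPolynomial (Fin n) k) * h + X i * pderiv i h) := by
  rw [Derivation.leibniz, smul_eq_mul, smul_eq_mul, mul_add, ← mul_assoc (X i) h, mul_comm (X i) h, mul_assoc h,
    X_mul_pderiv_monomial, one_mul, ← mul_one ((d i : ℕ) : k), ← natCast_mul_monomial]
  ring

/-- **A logarithmic minor of `(Y^{d₀} h₀, Y^{d₁} h₁)`** lies in `(h₀, h₁) + (plain 2 × 2 minors of h)`. [folklore] -/
theorem logMinor_monomial_mul_mem (d : Fin 2 → (Fin n →₀ ℕ)) (h : Fin 2 → MvPolynomial (Fin n) k) (v : Fin 2 → Fin n) :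
    (Matrix.of fun a l => (X (v a) : MvPolynomial (Fin n) k) * pderiv (v a) (monomial (d l) 1 * h l)).det ∈
      Ideal.span (Set.range h) ⊔
        Ideal.span (Set.range fun ii' : Fin n × Fin n =>
          (Matrix.of fun a l => pderiv (![ii'.1, ii'.2] a) (h l)).det) := by
  rw [logMinor_two, X_mul_pderiv_monomial_mul, X_mul_pderiv_monomial_mul, X_mul_pderiv_monomial_mul,
    X_mul_pderiv_monomial_mul]
  have h0 : h 0 ∈ Ideal.span (Set.range h) := Ideal.subset_span ⟨0, rfl⟩
  have h1 : h 1 ∈ Ideal.span (Set.range h) := Ideal.subset_span ⟨1, rfl⟩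
  have hm : (Matrix.of fun a l => pderiv (![v 0, v 1] a) (h l)).det ∈
      Ideal.span (Set.range fun ii' : Fin n × Fin n =>
        (Matrix.of fun a l => pderiv (![ii'.1, ii'.2] a) (h l)).det) := Ideal.subset_span ⟨(v 0, v 1), rfl⟩
  rw [minor_two] at hm
  simp only [Matrix.cons_val_zero, Matrix.cons_val_one] at hm
  -- the log-minor = `h₀ · C₀ + h₁ · C₁ + Y^{d₀ + d₁} Y_{v 0} Y_{v 1} · minor`
  have key : monomial (d 0) (1 : k) * (((d 0 (v 0) : ℕ) : MvPolynomial (Fin n) k) * h 0 + X (v 0) * pderiv (v 0) (h 0)) *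
        (monomial (d 1) 1 * (((d 1 (v 1) : ℕ) : MvPolynomial (Fin n) k) * h 1 + X (v 1) * pderiv (v 1) (h 1))) -
      monomial (d 1) 1 * (((d 1 (v 0) : ℕ) : MvPolynomial (Fin n) k) * h 1 + X (v 0) * pderiv (v 0) (h 1)) *
        (monomial (d 0) 1 * (((d 0 (v 1) : ℕ) : MvPolynomial (Fin n) k) * h 0 + X (v 1) * pderiv (v 1) (h 0))) =
      h 0 * (monomial (d 0) (1 : k) * monomial (d 1) 1 *
          (((d 0 (v 0) : ℕ) : MvPolynomial (Fin n) k) * ((d 1 (v 1) : ℕ) : MvPolynomial (Fin n) k) * h 1 +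
            ((d 0 (v 0) : ℕ) : MvPolynomial (Fin n) k) * (X (v 1) * pderiv (v 1) (h 1)) -
            ((d 1 (v 0) : ℕ) : MvPolynomial (Fin n) k) * ((d 0 (v 1) : ℕ) : MvPolynomial (Fin n) k) * h 1 -
            ((d 0 (v 1) : ℕ) : MvPolynomial (Fin n) k) * (X (v 0) * pderiv (v 0) (h 1)))) +
        h 1 * (monomial (d 0) (1 : k) * monomial (d 1) 1 *
          (((d 1 (v 1) : ℕ) : MvPolynomial (Fin n) k) * (X (v 0) * pderiv (v 0) (h 0)) -
            ((d 1 (v 0) : ℕ) : MvPolynomial (Fin n) k) * (X (v 1) * pderiv (v 1) (h 0)))) +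
        monomial (d 0) (1 : k) * monomial (d 1) 1 * X (v 0) * X (v 1) *
          (pderiv (v 0) (h 0) * pderiv (v 1) (h 1) - pderiv (v 0) (h 1) * pderiv (v 1) (h 0)) := by
    ring
  rw [key]
  exact Ideal.add_mem _ (Ideal.mem_sup_left (Ideal.add_mem _ (Ideal.mul_mem_right _ _ h0) (Ideal.mul_mem_right _ _ h1)))
    (Ideal.mem_sup_right (Ideal.mul_mem_left _ _ hm))

/-- **Transport of a logarithmic minor through a factorisation** `θ P_l = Y^{d_l} · h_l`: the image under `θ` of a logarithmic
`2 × 2` minor of `(P₀, P₁)` lies in `(h₀, h₁) + (plain 2 × 2 minors of h)`. [folklore] -/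
theorem theta_logMinor_mem_sup (V : Matrix (Fin n) (Fin n) ℕ) (hV : IsUnit (V.map (Nat.cast : ℕ → ℤ)).det)
    (P h : Fin 2 → MvPolynomial (Fin n) k) (d : Fin 2 → (Fin n →₀ ℕ))
    (hP : ∀ l, aeval (fun j : Fin n => ∏ i : Fin n, (X i : MvPolynomial (Fin n) k) ^ V i j) (P l) =
      monomial (d l) 1 * h l)
    (c : Fin 2 → Fin n) :
    aeval (fun j : Fin n => ∏ i : Fin n, (X i : MvPolynomial (Fin n) k) ^ V i j)
        (Matrix.of fun a l => (X (c a) : MvPolynomial (Fin n) k) * pderiv (c a) (P l)).det ∈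
      Ideal.span (Set.range h) ⊔
        Ideal.span (Set.range fun ii' : Fin n × Fin n =>
          (Matrix.of fun a l => pderiv (![ii'.1, ii'.2] a) (h l)).det) := by
  have hmem := theta_logMinor_mem V hV P c
  simp_rw [hP] at hmem
  refine (Ideal.span_le.mpr ?_) hmem
  rintro _ ⟨ii', rfl⟩
  exact logMinor_monomial_mul_mem d h ![ii'.1, ii'.2]

end Summit.ResolutionOfSingularities.ResolutionOfSingularities.Theorems.FInjectiveMacaulayfication.CIThetaTransport

end
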